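import Literature.MathematicalPhysics.QuantumFieldTheory.Balaban1983to89.B8Prop6CubeMemberGaugedReal
import Literature.MathematicalPhysics.QuantumFieldTheory.Balaban1983to89.B8Prop6CubeMemberGaugedRealBdryBeta
import Literature.MathematicalPhysics.QuantumFieldTheory.Balaban1983to89.B8Prop6CubeMemberFlatScalarGamma
import Literature.MathematicalPhysics.QuantumFieldTheory.Balaban1983to89.B8Prop6CubeMemberNormsFlatGamma

/-!
# `Balaban1983to89.B8Prop6CubeMemberGaugedRealGamma` — [Balaban1985RegularSpaces] PROPOSITION 6 (p. 99), (1.135)–(1.138) AS `Node00.GaugedBoundB8` AT EVERY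
# CUBE, FROM THE FLAT FOUR-LINE PROP.-3-FRAME SOCKET, THREE REAL INEQUALITY FAMILIES AND THEOREM 4's (1.59) CLAUSE AT BACKGROUND `1` — EDITION γ
# (averaging index over the split print class `cubeLamBP'` ∪ {level-0 crossing bonds of `□₀`}: inner AND crossing bonds at every level)

statement-level skeleton of published theorems with citation tags; proofs where landed; nothing here is a claim about the
Yang–Mills mass gap

PDF held: `paper:balaban1985-cmp99-regular-spaces-gauge-fixing`; Prop. 6 p. 99, Thm 4 p. 88, Prop. 3 p. 87, Prop. 5 pp. 93–94, (1.58)–(1.62) pp. 86–87, (1.31) p. 82.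
[4] = `[Balaban1985BackgroundPropagators]` Thms 3.1–3.3 pp. 397–399.

CITATION HEADER (lean-in-tree rule).  Cell `pub-ymgap` (HUMAN RULING D-0062, Track A), DAG node N05 = [B8], seat `pub-ymgap-dag-n05-e` g10 (R141 (C) row s3b —
the FLAT line of Proposition 6's cube road, edition γ; file Fγ6).  WHY THIS FILE.  g8's `B8Prop6CubeMemberGaugedRealBdryBeta` (p556116) assembles
`GaugedBoundB8` at every cube from the flat bodies in EDITION γ over `cubeLamB` — VACUOUS at cube members (shell modes, dag-n05-c p572834).  EDITION γ re-keys
both (1.59) inputs to the split print class `cubeLamBP'` and runs on this seat's γ bricks `B8Prop6CubeMemberNormsFlatGamma.norms136_cubeMember_flat_γ_d4` (Fγ3: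
(1.136)₂–₄ from the four-line flat socket) and `B8Prop6CubeMemberFlatScalarGamma.prop6_cubeMember_flat_of_real_γ` (Fγ5: the existence half from the REAL
families + `H59Dβ₁`); ★★ `gaugedBoundB8_cubeMember_real_γ`, ★★ `prop6Printed_zdCub_real_γ` (family form through `Node00.prop6Printed_zdCub_iff`).  Proofs =
p556116's with the γ substitutions.  Kind «kernel-checked proof», theorems only, no `def`.

HONEST SCOPE ∕ A6.  Per cube the hypotheses are: the four-line flat Prop.-3-frame socket at background `1` and Theorem 4's two-line clause `H59Dβ₁` over the
split print class ([4] Thm 3.3 at `U = 1` with exterior data — print's (1.59), named `Ineq159FlatCubeMemberPrinted` by dag-n05-c, OPEN; scalar form INHABITED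
per cube: dag-n05-w3 p585691 via `B8Ineq159FlatCubeMemberSCGamma`), and the three REAL families (discharged downstream by dag-n05-c on print's sub-lattice).
Nothing of [4] proved here; `B_∂`, `4B_∂ ≤ (dL − 1)B₀` displayed.  Count-neutral; N05 NOT discharged; one finite `𝕋⁴` programme at fixed `ε`, Bałaban as printed; nothing continuum ∕ ℝ⁴ ∕ OS ∕ mass-gap ∕ Clay.  No `sorry`, no
`def`, no `instance`, no `notation`.  Unit `pub-ymgap-dag-n05-e` (g10), 2026-08-28.
-/

noncomputable section

open NormedSpace

namespace Literature.MathematicalPhysics.QuantumFieldTheory.Balaban1983to89.B8Prop6CubeMemberGaugedRealGamma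

open scoped Matrix
open MatrixLog B7Prop1Explicit B7Prop2Explicit B7Prop1Local B7Eq92Concrete
open B7Prop3Flat (c3)
open B7Prop4GeneralLevels (logCovIter linCovIter)
open B8Ineq132 (covDerivFwd InAk BondTouches)
open B8Ineq133 (cutFixed)
open B8Lemma1NonAbelian (mulCfg)
open B8Eq115GaugeFixing (localGauge gaugeAct_mem_of)
open B8Eq119TwistedAxial (InAx Restr129)
open B8Eq140Level (SideTouches)
open B8Eq143PlaqExpansion (pdiv)
open B8Eq146AExpansion (iEta plaqCovDeriv)
open B8Eq155JBound (Jcur wsup)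
open B8ScaledSupNorm (bondNorm msup)
open B8Eq184Proof (gaugeExp cfgExp)
open B8Eq138LandauZd (IsLandau138W logCfg covLap)
open B8LambdaSpaceKLevel (wt)
open B8Eq131Cubes (tcube tLo tHi ctr)
open B8Eq131CubesAdmissible (cubeFam)
open B8CubeMemberZd (cubeLamS cubeLamB)
open B8Prop6OfThm4 (const_136 smallness_134)
open B8LeafModelZd (ZdIdx)
open B8Prop6CubeMemberNormsAt (windows136_of_small)
open B8Prop6CubeMemberNormsFlatGamma (norms136_cubeMember_flat_γ_d4)
open B8Prop6CubeMemberFlatScalarGamma (prop6_cubeMember_flat_of_real_γ)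
open B9SupplySockB9P3ZdGamma (cubeLamBP')
open B9SupplySockB9P3ZdBeta (CrossB)
open B8Prop6CubeMemberGauged (gaugedBoundB8_of_clauses)
open Node00 (CubeB8 GaugedBoundB8 zdCub prop6Printed_zdCub_iff)
open Literature.MathematicalPhysics.QuantumLattice (blockMap)

export B7Prop1Explicit (Site)

variable {d : ℕ}

variable {𝔸 : Type} [CStarAlgebra 𝔸] [Nontrivial 𝔸]

/-! ## §1 `GaugedBoundB8` at every cube from the flat bodies in the repaired currency -/

open Classical in
/-- ★★ **PROPOSITION 6 (p. 99), (1.135)–(1.138) AS `Node00.GaugedBoundB8` AT EVERY CUBE OF (1.131), FROM THE FLAT FOUR-LINE PROP.-3-FRAME γ SOCKET, THREE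
REAL INEQUALITY FAMILIES AND THEOREM 4's (1.59) CLAUSE `H59Dβ₁` AT BACKGROUND `1`** — p531701's `gaugedBoundB8_cubeMember_real_bdry` with both (1.59) inputs in EDITION γ
(averaging datum `|B₁|` over the split print class `cubeLamBP'` ∪ {level-0 crossing bonds of `□₀`} (inner AND crossing bonds at every level); per cube the bodies of dag-n06-b's `SockB9P3D4β` at the flat data); the three REAL
families VERBATIM; served by `B8Prop6CubeMemberNormsFlatGamma.norms136_cubeMember_flat_γ_d4` and `B8Prop6CubeMemberFlatScalarGamma.prop6_cubeMember_flat_of_real_γ`;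
proof verbatim. [cite: Balaban1985RegularSpaces, Prop. 6 (1.135)–(1.138) p.99, Thm 4 p.88, Prop. 3 p.87, Prop. 5 pp.93–94, (1.58)–(1.59) p.86, (1.31) p.82; Balaban1985BackgroundPropagators, Thms 3.1–3.3 pp.397–399] -/
theorem gaugedBoundB8_cubeMember_real_γ (hd2 : 2 ≤ d) {L : ℕ} (hL : 2 ≤ L) {B₀ B₀' C₂ cB9 B₀'H B₂' BG BR Bbd : ℝ} (hB₀ : 0 < B₀)
    (hB₀' : 0 < B₀') (hB : 2 ≤ 5 * (d : ℝ) * L * B₀) (hC₂ : 2097152 * ((d : ℝ) + 1) ^ 2 * (L : ℝ) ^ 2 ≤ C₂) (hcB9 : 0 < cB9)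
    (hB₀'H : 0 < B₀'H) (hB₂' : 0 ≤ B₂') (hBG : 0 ≤ BG) (hBR : 0 ≤ BR) (hfree : 3 * (2 * (d : ℝ) * (L : ℝ) ^ 2) * BG * BR ≤ B₀')
    (hBbd : 0 ≤ Bbd) (hBd : 4 * Bbd ≤ ((d : ℝ) * L - 1) * B₀) :
    ∃ c₁ : ℝ, 0 < c₁ ∧ ∀ (η : ℝ), 0 < η → ∀ {K : ℕ} {Ω : ℕ → Set (Site d)} (c : CubeB8 d L K Ω),
      -- (1.59) for `G(1)`, `H(1)` IN THE REPAIRED CURRENCY: the FOUR-LINE Prop.-3-frame socket at background `1` on the cube, collar term on each line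
      (∀ α₀' α₂ : ℝ, 0 < α₀' → α₀' ≤ cB9 → 0 < α₂ → α₂ ≤ cB9 →
        ∀ (W : Site d → Fin d → 𝔸ˣ), (∀ x κ, W x κ ∈ unitaryUnits 𝔸) →
        InAk L c.k η α₀' (cubeFam false L c.a c.M c.ρ c.k) (1 : Site d → Fin d → 𝔸ˣ) → InAk L c.k η α₀' (cubeFam false L c.a c.M c.ρ c.k) (mulCfg W (1 : Site d → Fin d → 𝔸ˣ)) →
        IsLandau138W L c.k η (cubeFam false L c.a c.M c.ρ c.k 0) (cubeLamS L c.a c.M c.ρ c.k c.k) (1 : Site d → Fin d → 𝔸ˣ) W →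
        ∀ A' : Site d → Fin d → 𝔸, (∀ y τ, IsSelfAdjoint (A' y τ)) →
        (∀ j, j ≤ c.k → ∀ (y : Site d) (τ : Fin d), SideTouches (cubeFam false L c.a c.M c.ρ c.k j) y τ →
          W y τ = cfgExp η A' y τ ∧ ‖A' y τ‖ ≤ α₂ * ((L : ℝ) ^ j * η)⁻¹) →
        (∀ (y : Site d) (τ : Fin d), (∀ j, j ≤ c.k → ¬ SideTouches (cubeFam false L c.a c.M c.ρ c.k j) y τ) → A' y τ = 0) →
        msup L c.k η (-(1 : ℝ)) (fun j (b : Site d × Fin d) => SideTouches (cubeFam false L c.a c.M c.ρ c.k j) b.1 b.2) (fun b => A' b.1 b.2)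
            ≤ B₀ * (bondNorm L c.k η (-(3 : ℝ)) (cubeFam false L c.a c.M c.ρ c.k) (fun x μ => Jcur η (1 : Site d → Fin d → 𝔸ˣ) A' μ x)
              + wsup 1 (fun p : {p : ℕ × (Site d × Fin d) // p.1 ≤ c.k ∧ (p.2 ∈ cubeLamBP' L c.a c.M c.ρ c.k c.k p.1 ∨ (p.1 = 0 ∧ CrossB ((cubeFam false L c.a c.M c.ρ c.k) 0) p.2))} =>
                  linCovIter L (1 : Site d → Fin d → 𝔸ˣ) (iEta η A') p.1.1 p.1.2.1 p.1.2.2))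
              + Bbd * msup L c.k η (-(1 : ℝ)) (fun j (b : Site d × Fin d) => j = 0 ∧ SideTouches (cubeFam false L c.a c.M c.ρ c.k 0) b.1 b.2 ∧
                  ¬ BondTouches (cubeFam false L c.a c.M c.ρ c.k 0) b.1 b.2) (fun b => A' b.1 b.2) ∧
          msup L c.k η (-(2 : ℝ)) (fun j (t : Fin d × Fin d × Site d) => SideTouches (cubeFam false L c.a c.M c.ρ c.k j) t.2.2 t.2.1)
              (fun t => covDerivFwd η (1 : Site d → Fin d → 𝔸ˣ) t.1 (fun z => A' z t.2.1) t.2.2)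
            ≤ B₀ * (bondNorm L c.k η (-(3 : ℝ)) (cubeFam false L c.a c.M c.ρ c.k) (fun x μ => Jcur η (1 : Site d → Fin d → 𝔸ˣ) A' μ x)
              + wsup 1 (fun p : {p : ℕ × (Site d × Fin d) // p.1 ≤ c.k ∧ (p.2 ∈ cubeLamBP' L c.a c.M c.ρ c.k c.k p.1 ∨ (p.1 = 0 ∧ CrossB ((cubeFam false L c.a c.M c.ρ c.k) 0) p.2))} =>
                  linCovIter L (1 : Site d → Fin d → 𝔸ˣ) (iEta η A') p.1.1 p.1.2.1 p.1.2.2))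
              + Bbd * msup L c.k η (-(1 : ℝ)) (fun j (b : Site d × Fin d) => j = 0 ∧ SideTouches (cubeFam false L c.a c.M c.ρ c.k 0) b.1 b.2 ∧
                  ¬ BondTouches (cubeFam false L c.a c.M c.ρ c.k 0) b.1 b.2) (fun b => A' b.1 b.2) ∧
          bondNorm L c.k η (-(3 : ℝ)) (cubeFam false L c.a c.M c.ρ c.k) (fun x μ => pdiv η (1 : Site d → Fin d → 𝔸ˣ) (plaqCovDeriv η (1 : Site d → Fin d → 𝔸ˣ) A') μ x)
            ≤ B₀ * (bondNorm L c.k η (-(3 : ℝ)) (cubeFam false L c.a c.M c.ρ c.k) (fun x μ => Jcur η (1 : Site d → Fin d → 𝔸ˣ) A' μ x)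
              + wsup 1 (fun p : {p : ℕ × (Site d × Fin d) // p.1 ≤ c.k ∧ (p.2 ∈ cubeLamBP' L c.a c.M c.ρ c.k c.k p.1 ∨ (p.1 = 0 ∧ CrossB ((cubeFam false L c.a c.M c.ρ c.k) 0) p.2))} =>
                  linCovIter L (1 : Site d → Fin d → 𝔸ˣ) (iEta η A') p.1.1 p.1.2.1 p.1.2.2))
              + Bbd * msup L c.k η (-(1 : ℝ)) (fun j (b : Site d × Fin d) => j = 0 ∧ SideTouches (cubeFam false L c.a c.M c.ρ c.k 0) b.1 b.2 ∧
                  ¬ BondTouches (cubeFam false L c.a c.M c.ρ c.k 0) b.1 b.2) (fun b => A' b.1 b.2) ∧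
          bondNorm L c.k η (-(3 : ℝ)) (cubeFam false L c.a c.M c.ρ c.k) (fun x μ => covLap η (1 : Site d → Fin d → 𝔸ˣ) (fun z => A' z μ) x)
            ≤ B₀ * (bondNorm L c.k η (-(3 : ℝ)) (cubeFam false L c.a c.M c.ρ c.k) (fun x μ => Jcur η (1 : Site d → Fin d → 𝔸ˣ) A' μ x)
              + wsup 1 (fun p : {p : ℕ × (Site d × Fin d) // p.1 ≤ c.k ∧ (p.2 ∈ cubeLamBP' L c.a c.M c.ρ c.k c.k p.1 ∨ (p.1 = 0 ∧ CrossB ((cubeFam false L c.a c.M c.ρ c.k) 0) p.2))} =>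
                  linCovIter L (1 : Site d → Fin d → 𝔸ˣ) (iEta η A') p.1.1 p.1.2.1 p.1.2.2))
              + Bbd * msup L c.k η (-(1 : ℝ)) (fun j (b : Site d × Fin d) => j = 0 ∧ SideTouches (cubeFam false L c.a c.M c.ρ c.k 0) b.1 b.2 ∧
                  ¬ BondTouches (cubeFam false L c.a c.M c.ρ c.k 0) b.1 b.2) (fun b => A' b.1 b.2)) →
      ∀ (U₀ : Site d → Fin d → 𝔸ˣ), (∀ x κ, U₀ x κ ∈ unitaryUnits 𝔸) → ∀ (α₀ : ℝ), 0 < α₀ → InAk L K η α₀ Ω U₀ →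
      7 * d * (L : ℝ) ^ 2 * c.M * α₀ ≤ c₁ →
      -- the weights of `Q′ᵀwQ′` and THE THREE REAL INEQUALITY FAMILIES on the explicit matrices at every truncation `n ≤ k`
      ∀ (w : ℕ → ℝ), (∀ j, 0 ≤ w j) →
      (∀ n, 1 ≤ n → n ≤ c.k → ∀ (S : Finset (Site d)), (∀ x, x ∈ S ↔ x ∈ cubeFam false L c.a c.M c.ρ c.k 0) →
        ∀ (B : Finset (ℕ × Site d)), (∀ p, p ∈ B ↔ p.1 ≤ n ∧ p.2 ∈ cubeLamS L c.a c.M c.ρ c.k n p.1) →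
        ∀ (K : Site d → Site d → ℝ), (∀ x z, K x z =
          ((η ^ 2)⁻¹ * ∑ μ : Fin d, ((2 : ℝ) * (if z = x then (1 : ℝ) else 0) - (if z = x + e μ then (1 : ℝ) else 0)
            - (if z = x - e μ then (1 : ℝ) else 0))) +
          (∑ j ∈ Finset.range (n + 1), (if blockMap (L ^ j) x ∈ cubeLamS L c.a c.M c.ρ c.k n j ∧ blockMap (L ^ j) z = blockMap (L ^ j) x then
            w j * ((((L : ℝ) ^ d)⁻¹) ^ j) ^ 2 else 0))) →
        ∀ (T : Matrix ↥S ↥S ℝ), T = Matrix.of (fun x z : ↥S => K x.1 z.1) →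
        ∀ (Q : Matrix ↥B ↥S ℝ), Q = Matrix.of (fun (p : ↥B) (z : ↥S) =>
          if blockMap (L ^ p.1.1) z.1 = p.1.2 then (((L : ℝ) ^ d)⁻¹) ^ p.1.1 else 0) →
        (∀ (ρ' : ↥S → ℝ) (r : ℝ), 0 ≤ r →
          (∀ j, j ≤ n → ∀ z : ↥S, z.1 ∈ cubeFam false L c.a c.M c.ρ c.k j → wt L η j ^ 2 * |ρ' z| ≤ r) →
          ∀ φ : Site d → ℝ, (∀ x, x ∉ cubeFam false L c.a c.M c.ρ c.k 0 → φ x = 0) → (∀ v : ↥S, φ v.1 = ∑ z : ↥S, T⁻¹ v z * ρ' z) →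
          (∀ x, |φ x| ≤ BG * r) ∧
          ∀ j, j ≤ n → ∀ p ∈ {b : Site d × Fin d | SideTouches (cubeFam false L c.a c.M c.ρ c.k j) b.1 b.2},
            wt L η j * |η⁻¹ * (φ (p.1 + e p.2) - φ p.1)| ≤ BG * r) ∧
        (∀ (X : ↥B → ℝ) (s : ℝ), 0 ≤ s → (∀ p', |X p'| ≤ s) →
          ∀ φ : Site d → ℝ, (∀ x, x ∉ cubeFam false L c.a c.M c.ρ c.k 0 → φ x = 0) →
          (∀ v : ↥S, φ v.1 = ∑ p' : ↥B, (T⁻¹ * (T⁻¹ * Qᵀ) * (Q * T⁻¹ * T⁻¹ * Qᵀ)⁻¹) v p' * X p') →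
          (∀ x, |φ x| ≤ B₀'H * s) ∧
          (∀ j, j ≤ n → ∀ p ∈ {b : Site d × Fin d | SideTouches (cubeFam false L c.a c.M c.ρ c.k j) b.1 b.2},
            wt L η j * |η⁻¹ * (φ (p.1 + e p.2) - φ p.1)| ≤ B₀'H * s) ∧
          (∀ j, j ≤ n → ∀ x ∈ cubeFam false L c.a c.M c.ρ c.k j,
            wt L η j ^ 2 * |∑ μ : Fin d, (η ^ 2)⁻¹ * (2 * φ x - φ (x + e μ) - φ (x - e μ))| ≤ B₂' * s)) ∧
        (∀ (ρ' : ↥S → ℝ) (r : ℝ), 0 ≤ r →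
          (∀ j, j ≤ n → ∀ z : ↥S, z.1 ∈ cubeFam false L c.a c.M c.ρ c.k j → wt L η j ^ 2 * |ρ' z| ≤ r) →
          ∀ j, j ≤ n → ∀ v : ↥S, v.1 ∈ cubeFam false L c.a c.M c.ρ c.k j →
            wt L η j ^ 2 * |ρ' v - ∑ z : ↥S, (T⁻¹ * (Qᵀ * ((Q * T⁻¹ * T⁻¹ * Qᵀ)⁻¹ * (Q * T⁻¹)))) v z * ρ' z| ≤ BR * r)) →
      -- (1.59) for `G(1)` IN THE REPAIRED CURRENCY: Theorem 4's two-member clause at background `1`, support clause + collar allowance (`H59D₁`)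
      ((∀ m, 1 ≤ m → m ≤ c.k → ∀ (u : Site d → 𝔸ˣ) (W : Site d → Fin d → 𝔸ˣ) (A' : Site d → Fin d → 𝔸),
        (∀ x, u x ∈ unitaryUnits 𝔸) → (∀ x, x ∉ (cubeFam false L c.a c.M c.ρ c.k) 0 → u x = 1) →
          mgauge (1 : Site d → Fin d → 𝔸ˣ) u W = (cutFixed L (tLo c.a c.ρ) (tHi c.a c.M c.ρ) U₀ c.k (ctr c.a c.M)) →
          Restr129 L m ((cubeLamS L c.a c.M c.ρ c.k) m) (1 : Site d → Fin d → 𝔸ˣ) u →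
          IsLandau138W L m η ((cubeFam false L c.a c.M c.ρ c.k) 0) ((cubeLamS L c.a c.M c.ρ c.k) m) (1 : Site d → Fin d → 𝔸ˣ) W →
        (∀ y τ, IsSelfAdjoint (A' y τ)) →
        (∀ j, j ≤ m → ∀ y τ, SideTouches ((cubeFam false L c.a c.M c.ρ c.k) j) y τ →
        W y τ = cfgExp η A' y τ ∧
          ‖A' y τ‖ ≤ (2 * (L * (5 * (d : ℝ) * L * B₀ * (((L : ℝ) ^ 3 * α₀) + (6 * d * (L : ℝ) ^ 2 * c.M * α₀)))) + 8 * (8 * B₀' * (5 * (d : ℝ) * L * B₀) * (((L : ℝ) ^ 3 * α₀) + (6 * d * (L : ℝ) ^ 2 * c.M * α₀)))) * ((L : ℝ) ^ j * η)⁻¹) →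
        (∀ y τ, (∀ j, j ≤ m → ¬ SideTouches ((cubeFam false L c.a c.M c.ρ c.k) j) y τ) → A' y τ = 0) →
        msup L m η (-(1 : ℝ)) (fun j (b : Site d × Fin d) => SideTouches ((cubeFam false L c.a c.M c.ρ c.k) j) b.1 b.2) (fun b => A' b.1 b.2)
        ≤ B₀ * (bondNorm L m η (-(3 : ℝ)) (cubeFam false L c.a c.M c.ρ c.k) (fun x μ => Jcur η (1 : Site d → Fin d → 𝔸ˣ) A' μ x)
        + wsup 1 (fun p : {p : ℕ × (Site d × Fin d) // p.1 ≤ m ∧ (p.2 ∈ (cubeLamBP' L c.a c.M c.ρ c.k) m p.1 ∨ (p.1 = 0 ∧ CrossB ((cubeFam false L c.a c.M c.ρ c.k) 0) p.2))} =>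
        linCovIter L (1 : Site d → Fin d → 𝔸ˣ) (iEta η A') p.1.1 p.1.2.1 p.1.2.2))
        + Bbd * msup L m η (-(1 : ℝ)) (fun j (b : Site d × Fin d) => j = 0 ∧ SideTouches ((cubeFam false L c.a c.M c.ρ c.k) 0) b.1 b.2 ∧
            ¬ BondTouches ((cubeFam false L c.a c.M c.ρ c.k) 0) b.1 b.2) (fun b => A' b.1 b.2) ∧
        msup L m η (-(2 : ℝ)) (fun j (t : Fin d × Fin d × Site d) => SideTouches ((cubeFam false L c.a c.M c.ρ c.k) j) t.2.2 t.2.1)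
        (fun t => covDerivFwd η (1 : Site d → Fin d → 𝔸ˣ) t.1 (fun z => A' z t.2.1) t.2.2)
        ≤ B₀ * (bondNorm L m η (-(3 : ℝ)) (cubeFam false L c.a c.M c.ρ c.k) (fun x μ => Jcur η (1 : Site d → Fin d → 𝔸ˣ) A' μ x)
        + wsup 1 (fun p : {p : ℕ × (Site d × Fin d) // p.1 ≤ m ∧ (p.2 ∈ (cubeLamBP' L c.a c.M c.ρ c.k) m p.1 ∨ (p.1 = 0 ∧ CrossB ((cubeFam false L c.a c.M c.ρ c.k) 0) p.2))} =>
        linCovIter L (1 : Site d → Fin d → 𝔸ˣ) (iEta η A') p.1.1 p.1.2.1 p.1.2.2))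
        + Bbd * msup L m η (-(1 : ℝ)) (fun j (b : Site d × Fin d) => j = 0 ∧ SideTouches ((cubeFam false L c.a c.M c.ρ c.k) 0) b.1 b.2 ∧
            ¬ BondTouches ((cubeFam false L c.a c.M c.ρ c.k) 0) b.1 b.2) (fun b => A' b.1 b.2))) →
      GaugedBoundB8 L η U₀ c (7 * d * (L : ℝ) ^ 2 * (5 * (d : ℝ) * L * B₀) * c.M * α₀) := by
  have hL1 : 1 ≤ L := le_trans (by norm_num) hL
  have hd1 : 1 ≤ d := le_trans (by norm_num) hd2
  have hLpos : (0 : ℝ) < L := by exact_mod_cast hL1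
  have hdpos : (0 : ℝ) < d := by exact_mod_cast hd1
  have hC₂0 : 0 ≤ C₂ := le_trans (by positivity) hC₂
  obtain ⟨c₄, hc₄, H4⟩ := prop6_cubeMember_flat_of_real_γ (𝔸 := 𝔸) hd2 hL hB₀ hB₀' hB hB₀'H hB₂' hBG hBR hfree hBbd hBd
  obtain ⟨c₃, hc₃, N3⟩ := norms136_cubeMember_flat_γ_d4 (𝔸 := 𝔸) hd2 hL hB₀ hC₂ hcB9 hBbd hBd
  obtain ⟨cW, hcW, W⟩ := windows136_of_small hd2 hL hB₀ hC₂0 hc₃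
  set B : ℝ := 5 * (d : ℝ) * L * B₀ with hB_def
  have hB0 : 0 < B := by positivity
  set C : ℝ := 131072 * ((d : ℝ) + 1) ^ 2 with hC_def
  have hC0 : 0 < C := by positivity
  refine ⟨min c₄ (min cW (1 / (16 * C * B))), lt_min hc₄ (lt_min hcW (by positivity)), ?_⟩
  intro η hη K Ω c SB9 U₀ hU₀ α₀ hα hAK hs w hw REAL H59
  -- the cube's laws as datum binders
  have hk : 1 ≤ c.k := c.one_le_k
  have hρL : L ≤ c.ρ := c.L_le_ρ
  have hρM : c.ρ ≤ c.M := c.ρ_le_M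
  have hρ : 1 ≤ c.ρ := hL1.trans hρL
  have hM1 : 1 ≤ c.M := hρ.trans hρM
  have hM : 11 * (d : ℝ) < c.M := by exact_mod_cast c.big
  have hLdM : (L : ℝ) ≤ d * c.M := by exact_mod_cast c.L_le_dM
  have hA : InAk L c.k η α₀ Ω U₀ := c.inAk hAK
  have hs₄ : 7 * d * (L : ℝ) ^ 2 * c.M * α₀ ≤ c₄ := hs.trans (min_le_left _ _)
  have hsW : 7 * d * (L : ℝ) ^ 2 * c.M * α₀ ≤ cW := hs.trans ((min_le_right _ _).trans (min_le_left _ _))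
  have hsC : 7 * d * (L : ℝ) ^ 2 * c.M * α₀ ≤ 1 / (16 * C * B) := hs.trans ((min_le_right _ _).trans (min_le_right _ _))
  -- every window from «7dL²Mα₀ ≤ c₁»
  obtain ⟨⟨hα3, hα2, hsmall⟩, ⟨hα₀c, hα₁c, hα₂c⟩, h61, ⟨-, -, h16, -, hc3α, hsmall₁⟩, h12⟩ := W c.M c.ρ hM1 hρM hM hLdM α₀ hα hsW
  -- PROPOSITION 6's existence half at the member FROM THE REAL FAMILIES + `H59D₁` (this seat's `B8Prop6CubeMemberFlatScalarBdry`)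
  obtain ⟨u, hu, huS, h129, hLan, h162, hw', h135⟩ := H4 η hη c.k hk c.a c.M c.ρ hρL hρM hM U₀ hU₀ α₀ hα hα3 hα2 Ω hA
    c.tcube_sub hsmall (smallness_134 hLpos hα hLdM hs₄) w hw REAL H59
  -- PROPOSITION 3's norm members at the member FROM THE FOUR-LINE FLAT SOCKET (this seat's `B8Prop6CubeMemberNormsFlatBdry4`)
  obtain ⟨h136g, h139j, h139l⟩ := N3 η hη c.k hk c.a c.M c.ρ hρL hρM hM SB9 U₀ hU₀ α₀ hα hα3 hα2 Ω hA c.tcube_sub hsmall hα₀c hα₂c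
    h61 hsmall₁ u hu huS h129 hLan h162
  -- the three norm members of (1.136), with print's constant (`const_136`)
  have hconst : B * ((L : ℝ) ^ 3 * α₀ + 6 * d * (L : ℝ) ^ 2 * c.M * α₀) ≤ 7 * d * (L : ℝ) ^ 2 * B * c.M * α₀ :=
    const_136 hLpos hα hB0.le hLdM
  have h136₂ := h136g.trans hconst
  have h136₃ := h139j.trans hconst
  have h136₄ := h139l.trans hconst
  have h16C : 16 * (131072 * ((d : ℝ) + 1) ^ 2) * (B * ((L : ℝ) ^ 3 * α₀ + 6 * d * (L : ℝ) ^ 2 * c.M * α₀)) ≤ 1 := by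
    have e1 : B * ((L : ℝ) ^ 3 * α₀ + 6 * d * (L : ℝ) ^ 2 * c.M * α₀) ≤ 7 * d * (L : ℝ) ^ 2 * B * c.M * α₀ := hconst
    have e3 : B * (7 * d * (L : ℝ) ^ 2 * c.M * α₀) ≤ B * (1 / (16 * C * B)) := mul_le_mul_of_nonneg_left hsC hB0.le
    have e4 : B * (1 / (16 * C * B)) = 1 / (16 * C) := by field_simp
    have e2 : 7 * d * (L : ℝ) ^ 2 * B * c.M * α₀ = B * (7 * d * (L : ℝ) ^ 2 * c.M * α₀) := by ring
    have e5 : B * ((L : ℝ) ^ 3 * α₀ + 6 * d * (L : ℝ) ^ 2 * c.M * α₀) ≤ 1 / (16 * C) := by linarith [e1, e3]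
    calc 16 * (131072 * ((d : ℝ) + 1) ^ 2) * (B * ((L : ℝ) ^ 3 * α₀ + 6 * d * (L : ℝ) ^ 2 * c.M * α₀))
        ≤ 16 * C * (1 / (16 * C)) := mul_le_mul_of_nonneg_left e5 (by positivity)
      _ = 1 := by field_simp
  exact gaugedBoundB8_of_clauses hd2 hL hB₀ hη c U₀ hU₀ hα hA hα3 hα2 hsmall h12 h16C hc3α u hu huS h129 hLan h162 hw' h135
    h136₂ h136₃ h136₄

#print axioms gaugedBoundB8_cubeMember_real_γ

/-! ## §2 `B8.Prop6Printed` on `zdCub ∘ f` from the flat bodies in the repaired currency -/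

open Classical in
/-- ★★ **`B8.Prop6Printed d L (5dLB₀) c₁` ON `zdCub ∘ f` FROM, PER CUBE, THE FLAT FOUR-LINE γ SOCKET, THE THREE REAL FAMILIES AND `H59Dβ₁`** —
p531701's `prop6Printed_zdCub_real_bdry` in EDITION γ (`gaugedBoundB8_cubeMember_real_γ` through `Node00.prop6Printed_zdCub_iff`).
[cite: Balaban1985RegularSpaces, Prop. 6 p.99, Thm 4 p.88, Prop. 3 p.87, (1.59) p.86, (1.31) p.82] -/
theorem prop6Printed_zdCub_real_γ (hd2 : 2 ≤ d) {L : ℕ} (hL : 2 ≤ L) {B₀ B₀' C₂ cB9 B₀'H B₂' BG BR Bbd : ℝ} (hB₀ : 0 < B₀)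
    (hB₀' : 0 < B₀') (hB : 2 ≤ 5 * (d : ℝ) * L * B₀) (hC₂ : 2097152 * ((d : ℝ) + 1) ^ 2 * (L : ℝ) ^ 2 ≤ C₂) (hcB9 : 0 < cB9)
    (hB₀'H : 0 < B₀'H) (hB₂' : 0 ≤ B₂') (hBG : 0 ≤ BG) (hBR : 0 ≤ BR) (hfree : 3 * (2 * (d : ℝ) * (L : ℝ) ^ 2) * BG * BR ≤ B₀')
    (hBbd : 0 ≤ Bbd) (hBd : 4 * Bbd ≤ ((d : ℝ) * L - 1) * B₀) :
    ∃ c₁ : ℝ, 0 < c₁ ∧ ∀ {ι : Type} (f : ι → ZdIdx d L),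
      (∀ (i : ι) (c : CubeB8 d L (f i).k (f i).Ω),
      (∀ α₀' α₂ : ℝ, 0 < α₀' → α₀' ≤ cB9 → 0 < α₂ → α₂ ≤ cB9 →
        ∀ (W : Site d → Fin d → 𝔸ˣ), (∀ x κ, W x κ ∈ unitaryUnits 𝔸) →
        InAk L c.k (f i).η α₀' (cubeFam false L c.a c.M c.ρ c.k) (1 : Site d → Fin d → 𝔸ˣ) → InAk L c.k (f i).η α₀' (cubeFam false L c.a c.M c.ρ c.k) (mulCfg W (1 : Site d → Fin d → 𝔸ˣ)) →
        IsLandau138W L c.k (f i).η (cubeFam false L c.a c.M c.ρ c.k 0) (cubeLamS L c.a c.M c.ρ c.k c.k) (1 : Site d → Fin d → 𝔸ˣ) W →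
        ∀ A' : Site d → Fin d → 𝔸, (∀ y τ, IsSelfAdjoint (A' y τ)) →
        (∀ j, j ≤ c.k → ∀ (y : Site d) (τ : Fin d), SideTouches (cubeFam false L c.a c.M c.ρ c.k j) y τ →
          W y τ = cfgExp (f i).η A' y τ ∧ ‖A' y τ‖ ≤ α₂ * ((L : ℝ) ^ j * (f i).η)⁻¹) →
        (∀ (y : Site d) (τ : Fin d), (∀ j, j ≤ c.k → ¬ SideTouches (cubeFam false L c.a c.M c.ρ c.k j) y τ) → A' y τ = 0) →
        msup L c.k (f i).η (-(1 : ℝ)) (fun j (b : Site d × Fin d) => SideTouches (cubeFam false L c.a c.M c.ρ c.k j) b.1 b.2) (fun b => A' b.1 b.2)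
            ≤ B₀ * (bondNorm L c.k (f i).η (-(3 : ℝ)) (cubeFam false L c.a c.M c.ρ c.k) (fun x μ => Jcur (f i).η (1 : Site d → Fin d → 𝔸ˣ) A' μ x)
              + wsup 1 (fun p : {p : ℕ × (Site d × Fin d) // p.1 ≤ c.k ∧ (p.2 ∈ cubeLamBP' L c.a c.M c.ρ c.k c.k p.1 ∨ (p.1 = 0 ∧ CrossB ((cubeFam false L c.a c.M c.ρ c.k) 0) p.2))} =>
                  linCovIter L (1 : Site d → Fin d → 𝔸ˣ) (iEta (f i).η A') p.1.1 p.1.2.1 p.1.2.2))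
              + Bbd * msup L c.k (f i).η (-(1 : ℝ)) (fun j (b : Site d × Fin d) => j = 0 ∧ SideTouches (cubeFam false L c.a c.M c.ρ c.k 0) b.1 b.2 ∧
                  ¬ BondTouches (cubeFam false L c.a c.M c.ρ c.k 0) b.1 b.2) (fun b => A' b.1 b.2) ∧
          msup L c.k (f i).η (-(2 : ℝ)) (fun j (t : Fin d × Fin d × Site d) => SideTouches (cubeFam false L c.a c.M c.ρ c.k j) t.2.2 t.2.1)
              (fun t => covDerivFwd (f i).η (1 : Site d → Fin d → 𝔸ˣ) t.1 (fun z => A' z t.2.1) t.2.2)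
            ≤ B₀ * (bondNorm L c.k (f i).η (-(3 : ℝ)) (cubeFam false L c.a c.M c.ρ c.k) (fun x μ => Jcur (f i).η (1 : Site d → Fin d → 𝔸ˣ) A' μ x)
              + wsup 1 (fun p : {p : ℕ × (Site d × Fin d) // p.1 ≤ c.k ∧ (p.2 ∈ cubeLamBP' L c.a c.M c.ρ c.k c.k p.1 ∨ (p.1 = 0 ∧ CrossB ((cubeFam false L c.a c.M c.ρ c.k) 0) p.2))} =>
                  linCovIter L (1 : Site d → Fin d → 𝔸ˣ) (iEta (f i).η A') p.1.1 p.1.2.1 p.1.2.2))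
              + Bbd * msup L c.k (f i).η (-(1 : ℝ)) (fun j (b : Site d × Fin d) => j = 0 ∧ SideTouches (cubeFam false L c.a c.M c.ρ c.k 0) b.1 b.2 ∧
                  ¬ BondTouches (cubeFam false L c.a c.M c.ρ c.k 0) b.1 b.2) (fun b => A' b.1 b.2) ∧
          bondNorm L c.k (f i).η (-(3 : ℝ)) (cubeFam false L c.a c.M c.ρ c.k) (fun x μ => pdiv (f i).η (1 : Site d → Fin d → 𝔸ˣ) (plaqCovDeriv (f i).η (1 : Site d → Fin d → 𝔸ˣ) A') μ x)
            ≤ B₀ * (bondNorm L c.k (f i).η (-(3 : ℝ)) (cubeFam false L c.a c.M c.ρ c.k) (fun x μ => Jcur (f i).η (1 : Site d → Fin d → 𝔸ˣ) A' μ x)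
              + wsup 1 (fun p : {p : ℕ × (Site d × Fin d) // p.1 ≤ c.k ∧ (p.2 ∈ cubeLamBP' L c.a c.M c.ρ c.k c.k p.1 ∨ (p.1 = 0 ∧ CrossB ((cubeFam false L c.a c.M c.ρ c.k) 0) p.2))} =>
                  linCovIter L (1 : Site d → Fin d → 𝔸ˣ) (iEta (f i).η A') p.1.1 p.1.2.1 p.1.2.2))
              + Bbd * msup L c.k (f i).η (-(1 : ℝ)) (fun j (b : Site d × Fin d) => j = 0 ∧ SideTouches (cubeFam false L c.a c.M c.ρ c.k 0) b.1 b.2 ∧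
                  ¬ BondTouches (cubeFam false L c.a c.M c.ρ c.k 0) b.1 b.2) (fun b => A' b.1 b.2) ∧
          bondNorm L c.k (f i).η (-(3 : ℝ)) (cubeFam false L c.a c.M c.ρ c.k) (fun x μ => covLap (f i).η (1 : Site d → Fin d → 𝔸ˣ) (fun z => A' z μ) x)
            ≤ B₀ * (bondNorm L c.k (f i).η (-(3 : ℝ)) (cubeFam false L c.a c.M c.ρ c.k) (fun x μ => Jcur (f i).η (1 : Site d → Fin d → 𝔸ˣ) A' μ x)
              + wsup 1 (fun p : {p : ℕ × (Site d × Fin d) // p.1 ≤ c.k ∧ (p.2 ∈ cubeLamBP' L c.a c.M c.ρ c.k c.k p.1 ∨ (p.1 = 0 ∧ CrossB ((cubeFam false L c.a c.M c.ρ c.k) 0) p.2))} =>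
                  linCovIter L (1 : Site d → Fin d → 𝔸ˣ) (iEta (f i).η A') p.1.1 p.1.2.1 p.1.2.2))
              + Bbd * msup L c.k (f i).η (-(1 : ℝ)) (fun j (b : Site d × Fin d) => j = 0 ∧ SideTouches (cubeFam false L c.a c.M c.ρ c.k 0) b.1 b.2 ∧
                  ¬ BondTouches (cubeFam false L c.a c.M c.ρ c.k 0) b.1 b.2) (fun b => A' b.1 b.2)) ∧
      ∀ (U₀ : Site d → Fin d → 𝔸ˣ), (∀ x κ, U₀ x κ ∈ unitaryUnits 𝔸) → ∀ (α₀ : ℝ), 0 < α₀ → InAk L (f i).k (f i).η α₀ (f i).Ω U₀ →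
      (∃ w : ℕ → ℝ, (∀ j, 0 ≤ w j) ∧
      (∀ n, 1 ≤ n → n ≤ c.k → ∀ (S : Finset (Site d)), (∀ x, x ∈ S ↔ x ∈ cubeFam false L c.a c.M c.ρ c.k 0) →
        ∀ (B : Finset (ℕ × Site d)), (∀ p, p ∈ B ↔ p.1 ≤ n ∧ p.2 ∈ cubeLamS L c.a c.M c.ρ c.k n p.1) →
        ∀ (K : Site d → Site d → ℝ), (∀ x z, K x z =
          (((f i).η ^ 2)⁻¹ * ∑ μ : Fin d, ((2 : ℝ) * (if z = x then (1 : ℝ) else 0) - (if z = x + e μ then (1 : ℝ) else 0)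
            - (if z = x - e μ then (1 : ℝ) else 0))) +
          (∑ j ∈ Finset.range (n + 1), (if blockMap (L ^ j) x ∈ cubeLamS L c.a c.M c.ρ c.k n j ∧ blockMap (L ^ j) z = blockMap (L ^ j) x then
            w j * ((((L : ℝ) ^ d)⁻¹) ^ j) ^ 2 else 0))) →
        ∀ (T : Matrix ↥S ↥S ℝ), T = Matrix.of (fun x z : ↥S => K x.1 z.1) →
        ∀ (Q : Matrix ↥B ↥S ℝ), Q = Matrix.of (fun (p : ↥B) (z : ↥S) =>
          if blockMap (L ^ p.1.1) z.1 = p.1.2 then (((L : ℝ) ^ d)⁻¹) ^ p.1.1 else 0) →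
        (∀ (ρ' : ↥S → ℝ) (r : ℝ), 0 ≤ r →
          (∀ j, j ≤ n → ∀ z : ↥S, z.1 ∈ cubeFam false L c.a c.M c.ρ c.k j → wt L (f i).η j ^ 2 * |ρ' z| ≤ r) →
          ∀ φ : Site d → ℝ, (∀ x, x ∉ cubeFam false L c.a c.M c.ρ c.k 0 → φ x = 0) → (∀ v : ↥S, φ v.1 = ∑ z : ↥S, T⁻¹ v z * ρ' z) →
          (∀ x, |φ x| ≤ BG * r) ∧
          ∀ j, j ≤ n → ∀ p ∈ {b : Site d × Fin d | SideTouches (cubeFam false L c.a c.M c.ρ c.k j) b.1 b.2},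
            wt L (f i).η j * |((f i).η)⁻¹ * (φ (p.1 + e p.2) - φ p.1)| ≤ BG * r) ∧
        (∀ (X : ↥B → ℝ) (s : ℝ), 0 ≤ s → (∀ p', |X p'| ≤ s) →
          ∀ φ : Site d → ℝ, (∀ x, x ∉ cubeFam false L c.a c.M c.ρ c.k 0 → φ x = 0) →
          (∀ v : ↥S, φ v.1 = ∑ p' : ↥B, (T⁻¹ * (T⁻¹ * Qᵀ) * (Q * T⁻¹ * T⁻¹ * Qᵀ)⁻¹) v p' * X p') →
          (∀ x, |φ x| ≤ B₀'H * s) ∧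
          (∀ j, j ≤ n → ∀ p ∈ {b : Site d × Fin d | SideTouches (cubeFam false L c.a c.M c.ρ c.k j) b.1 b.2},
            wt L (f i).η j * |((f i).η)⁻¹ * (φ (p.1 + e p.2) - φ p.1)| ≤ B₀'H * s) ∧
          (∀ j, j ≤ n → ∀ x ∈ cubeFam false L c.a c.M c.ρ c.k j,
            wt L (f i).η j ^ 2 * |∑ μ : Fin d, ((f i).η ^ 2)⁻¹ * (2 * φ x - φ (x + e μ) - φ (x - e μ))| ≤ B₂' * s)) ∧
        (∀ (ρ' : ↥S → ℝ) (r : ℝ), 0 ≤ r →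
          (∀ j, j ≤ n → ∀ z : ↥S, z.1 ∈ cubeFam false L c.a c.M c.ρ c.k j → wt L (f i).η j ^ 2 * |ρ' z| ≤ r) →
          ∀ j, j ≤ n → ∀ v : ↥S, v.1 ∈ cubeFam false L c.a c.M c.ρ c.k j →
            wt L (f i).η j ^ 2 * |ρ' v - ∑ z : ↥S, (T⁻¹ * (Qᵀ * ((Q * T⁻¹ * T⁻¹ * Qᵀ)⁻¹ * (Q * T⁻¹)))) v z * ρ' z| ≤ BR * r))) ∧
      ((∀ m, 1 ≤ m → m ≤ c.k → ∀ (u : Site d → 𝔸ˣ) (W : Site d → Fin d → 𝔸ˣ) (A' : Site d → Fin d → 𝔸),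
        (∀ x, u x ∈ unitaryUnits 𝔸) → (∀ x, x ∉ (cubeFam false L c.a c.M c.ρ c.k) 0 → u x = 1) →
          mgauge (1 : Site d → Fin d → 𝔸ˣ) u W = (cutFixed L (tLo c.a c.ρ) (tHi c.a c.M c.ρ) U₀ c.k (ctr c.a c.M)) →
          Restr129 L m ((cubeLamS L c.a c.M c.ρ c.k) m) (1 : Site d → Fin d → 𝔸ˣ) u →
          IsLandau138W L m (f i).η ((cubeFam false L c.a c.M c.ρ c.k) 0) ((cubeLamS L c.a c.M c.ρ c.k) m) (1 : Site d → Fin d → 𝔸ˣ) W →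
        (∀ y τ, IsSelfAdjoint (A' y τ)) →
        (∀ j, j ≤ m → ∀ y τ, SideTouches ((cubeFam false L c.a c.M c.ρ c.k) j) y τ →
        W y τ = cfgExp (f i).η A' y τ ∧
          ‖A' y τ‖ ≤ (2 * (L * (5 * (d : ℝ) * L * B₀ * (((L : ℝ) ^ 3 * α₀) + (6 * d * (L : ℝ) ^ 2 * c.M * α₀)))) + 8 * (8 * B₀' * (5 * (d : ℝ) * L * B₀) * (((L : ℝ) ^ 3 * α₀) + (6 * d * (L : ℝ) ^ 2 * c.M * α₀)))) * ((L : ℝ) ^ j * (f i).η)⁻¹) →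
        (∀ y τ, (∀ j, j ≤ m → ¬ SideTouches ((cubeFam false L c.a c.M c.ρ c.k) j) y τ) → A' y τ = 0) →
        msup L m (f i).η (-(1 : ℝ)) (fun j (b : Site d × Fin d) => SideTouches ((cubeFam false L c.a c.M c.ρ c.k) j) b.1 b.2) (fun b => A' b.1 b.2)
        ≤ B₀ * (bondNorm L m (f i).η (-(3 : ℝ)) (cubeFam false L c.a c.M c.ρ c.k) (fun x μ => Jcur (f i).η (1 : Site d → Fin d → 𝔸ˣ) A' μ x)
        + wsup 1 (fun p : {p : ℕ × (Site d × Fin d) // p.1 ≤ m ∧ (p.2 ∈ (cubeLamBP' L c.a c.M c.ρ c.k) m p.1 ∨ (p.1 = 0 ∧ CrossB ((cubeFam false L c.a c.M c.ρ c.k) 0) p.2))} =>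
        linCovIter L (1 : Site d → Fin d → 𝔸ˣ) (iEta (f i).η A') p.1.1 p.1.2.1 p.1.2.2))
        + Bbd * msup L m (f i).η (-(1 : ℝ)) (fun j (b : Site d × Fin d) => j = 0 ∧ SideTouches ((cubeFam false L c.a c.M c.ρ c.k) 0) b.1 b.2 ∧
            ¬ BondTouches ((cubeFam false L c.a c.M c.ρ c.k) 0) b.1 b.2) (fun b => A' b.1 b.2) ∧
        msup L m (f i).η (-(2 : ℝ)) (fun j (t : Fin d × Fin d × Site d) => SideTouches ((cubeFam false L c.a c.M c.ρ c.k) j) t.2.2 t.2.1)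
        (fun t => covDerivFwd (f i).η (1 : Site d → Fin d → 𝔸ˣ) t.1 (fun z => A' z t.2.1) t.2.2)
        ≤ B₀ * (bondNorm L m (f i).η (-(3 : ℝ)) (cubeFam false L c.a c.M c.ρ c.k) (fun x μ => Jcur (f i).η (1 : Site d → Fin d → 𝔸ˣ) A' μ x)
        + wsup 1 (fun p : {p : ℕ × (Site d × Fin d) // p.1 ≤ m ∧ (p.2 ∈ (cubeLamBP' L c.a c.M c.ρ c.k) m p.1 ∨ (p.1 = 0 ∧ CrossB ((cubeFam false L c.a c.M c.ρ c.k) 0) p.2))} =>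
        linCovIter L (1 : Site d → Fin d → 𝔸ˣ) (iEta (f i).η A') p.1.1 p.1.2.1 p.1.2.2))
        + Bbd * msup L m (f i).η (-(1 : ℝ)) (fun j (b : Site d × Fin d) => j = 0 ∧ SideTouches ((cubeFam false L c.a c.M c.ρ c.k) 0) b.1 b.2 ∧
            ¬ BondTouches ((cubeFam false L c.a c.M c.ρ c.k) 0) b.1 b.2) (fun b => A' b.1 b.2)))) →
      B8.Prop6Printed d (L : ℝ) (5 * (d : ℝ) * L * B₀) c₁ (fun j => zdCub 𝔸 L (f j)) := by
  obtain ⟨c₁, hc₁, G⟩ := gaugedBoundB8_cubeMember_real_γ (𝔸 := 𝔸) hd2 hL hB₀ hB₀' hB hC₂ hcB9 hB₀'H hB₂' hBG hBR hfree hBbd hBd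
  refine ⟨c₁, hc₁, fun f S => ?_⟩
  rw [prop6Printed_zdCub_iff]
  intro j α₀ hα U₀ hInA c hs
  obtain ⟨S₉, ST⟩ := S j c
  obtain ⟨⟨w, hw, REAL⟩, H59⟩ := ST U₀.1 U₀.2 α₀ hα hInA
  exact G (f j).η (f j).hη c S₉ U₀.1 U₀.2 α₀ hα hInA hs w hw REAL H59

#print axioms prop6Printed_zdCub_real_γ

end Literature.MathematicalPhysics.QuantumFieldTheory.Balaban1983to89.B8Prop6CubeMemberGaugedRealGamma

end
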